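import Mathlib
import HarnessLib

/-!
# Venture HSemireg — the supertrace step of «(W³) on the flat stratum»

HONEST FRAMING. Lean leaf for the computation cell `pub-hsemireg` (theory seat th-3 gen 28; file of
record `run/shared/lean/pub/pub-hsemireg/theory/TH3-SIGMA-ORBIT-PROOF.md` v1.4 §7, 2026-08-24).
There, for a FLAT pencil of odd gluing operators (`{u_a, u_b} = 0`) the «defect formula» (§7.2,
pencil) shows that every class component `B^c_i = {u_{i-1}, V^c_{i+1}}` commutes with every `u_l`;
hence every word in the `B`'s has the shape `Z ∘ (x ∘ η + η ∘ x) ∘ Z'` with `x = u_{i-1}` odd and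
`Z, Z'` commuting with `x`, and the theorem «the B-algebra is supertraceless, in particular
str T = 0, i.e. (W³)» reduces to the identity kernel-checked HERE: on the total space `U` with
parity operator `σ` (supertrace of `X` = `trace (σ ∘ X)`), if `σ ∘ x = -(x ∘ σ)` and `Z, Z'`
commute with `x`, then `trace (σ ∘ (Z ∘ (x ∘ η + η ∘ x) ∘ Z')) = 0` for every `η`.
The defect formula, flatness, the classes and the model are NOT formalised; no object is
constructed; nothing here bears on HC, HC_CM or HC_AV.
-/

namespace Summit.Ventures.HSemireg

open LinearMap

variable {F : Type*} [Field F]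
variable {U : Type*} [AddCommGroup U] [Module F U] [FiniteDimensional F U]

/-- **Supertrace of an `x`-anticommutator.** If the parity operator `σ` anticommutes with `x`
(`σ ∘ x = -(x ∘ σ)`, i.e. `x` is odd), then for every `w` the anticommutator `x ∘ w + w ∘ x` has
zero supertrace: `trace (σ ∘ (x ∘ w + w ∘ x)) = 0`. Proof: by cyclicity
`trace (σ ∘ w ∘ x) = trace (x ∘ σ ∘ w) = -trace (σ ∘ x ∘ w)`. [folklore] -/
theorem trace_parity_anticomm_eq_zero (σ x w : U →ₗ[F] U) (hσx : σ ∘ₗ x = -(x ∘ₗ σ)) :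
    LinearMap.trace F U (σ ∘ₗ (x ∘ₗ w + w ∘ₗ x)) = 0 := by
  have h2 : LinearMap.trace F U (σ ∘ₗ w ∘ₗ x) = -LinearMap.trace F U (σ ∘ₗ x ∘ₗ w) := by
    have e1 : σ ∘ₗ w ∘ₗ x = (σ ∘ₗ w) ∘ₗ x := by simp only [LinearMap.comp_assoc]
    have e2 : x ∘ₗ (σ ∘ₗ w) = -(σ ∘ₗ x ∘ₗ w) := by
      have : x ∘ₗ σ = -(σ ∘ₗ x) := by rw [hσx, neg_neg]
      rw [← LinearMap.comp_assoc, this, LinearMap.neg_comp, LinearMap.comp_assoc]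
    rw [e1, LinearMap.trace_comp_comm', e2, map_neg]
  have expand : σ ∘ₗ (x ∘ₗ w + w ∘ₗ x) = σ ∘ₗ x ∘ₗ w + σ ∘ₗ w ∘ₗ x := by
    simp only [LinearMap.comp_add]
  rw [expand, map_add, h2, add_neg_cancel]

omit [FiniteDimensional F U] in
/-- **Conjugating an `x`-anticommutator by operators commuting with `x`.** If `Z` and `Z'`
commute with `x`, then `Z ∘ (x ∘ η + η ∘ x) ∘ Z' = x ∘ (Z ∘ η ∘ Z') + (Z ∘ η ∘ Z') ∘ x`:
a word containing one `x`-exact factor, all other factors commuting with `x`, is again `x`-exact.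
(TH3-SIGMA-ORBIT-PROOF §7.3.) [folklore] -/
theorem conj_anticomm_eq_anticomm (x η Z Z' : U →ₗ[F] U)
    (hZ : Z ∘ₗ x = x ∘ₗ Z) (hZ' : Z' ∘ₗ x = x ∘ₗ Z') :
    Z ∘ₗ (x ∘ₗ η + η ∘ₗ x) ∘ₗ Z' = x ∘ₗ (Z ∘ₗ η ∘ₗ Z') + (Z ∘ₗ η ∘ₗ Z') ∘ₗ x := by
  have e1 : Z ∘ₗ (x ∘ₗ η + η ∘ₗ x) ∘ₗ Z' = (Z ∘ₗ x) ∘ₗ η ∘ₗ Z' + Z ∘ₗ η ∘ₗ (x ∘ₗ Z') := by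
    simp only [LinearMap.comp_add, LinearMap.add_comp, LinearMap.comp_assoc]
  rw [e1, hZ, ← hZ']
  simp only [LinearMap.comp_assoc]

/-- **Supertrace step of (W³) on the flat stratum.** With `σ` the parity operator and `x` odd
(`σ ∘ x = -(x ∘ σ)`), every operator of the form `Z ∘ (x ∘ η + η ∘ x) ∘ Z'` with `Z, Z'` commuting
with `x` has zero supertrace. In TH3-SIGMA-ORBIT-PROOF §7.3 this is applied to every word in the
class components `B^c_i` of a flat (E1)∧(E2) configuration (there `x = u_{i-1}`,
`η = V^c_{i+1}`, and `Z, Z'` commute with `x` by the defect formula), giving `str T = 0`.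
[folklore] -/
theorem supertrace_conj_anticomm_eq_zero (σ x η Z Z' : U →ₗ[F] U)
    (hσx : σ ∘ₗ x = -(x ∘ₗ σ)) (hZ : Z ∘ₗ x = x ∘ₗ Z) (hZ' : Z' ∘ₗ x = x ∘ₗ Z') :
    LinearMap.trace F U (σ ∘ₗ (Z ∘ₗ (x ∘ₗ η + η ∘ₗ x) ∘ₗ Z')) = 0 := by
  rw [conj_anticomm_eq_anticomm x η Z Z' hZ hZ']
  exact trace_parity_anticomm_eq_zero σ x (Z ∘ₗ η ∘ₗ Z') hσx

end Summit.Ventures.HSemireg
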